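import Mathlib.RingTheory.DiscreteValuationRing.TFAE
import Mathlib.RingTheory.Ideal.AssociatedPrime.Basic
import Mathlib.RingTheory.Ideal.Height
import Mathlib.RingTheory.IntegralClosure.IntegrallyClosed
import Mathlib.RingTheory.Localization.AtPrime.Basic
import Mathlib.RingTheory.Localization.Submodule
import Mathlib.RingTheory.RegularLocalRing.Defs

import HarnessLib

/-!
# Normal Noetherian domains: prime divisors of principal ideals and `R = ⋂_{ht P = 1} R_P`

Topic `Literature/RingTheory/IntegralClosure`. Matsumura, *Commutative Ring Theory*, Thm. 11.5
(Krull): for a normal (integrally closed) Noetherian domain `R`,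

* (i) every prime divisor `P = (aR : c)` of a non-zero principal ideal `aR` has height one and
  `R_P` is a discrete valuation ring — `isPrincipal_maximalIdeal_of_eq_colon` (the maximal ideal of
  `R_P` is principal: with `x = c/a`, `x P ⊆ R`; `x P ⊆ P` is excluded by the determinant trick and
  normality, so `x p₀ ∉ P` for some `p₀ ∈ P` and `P R_P = p₀ R_P`),
  `isDiscreteValuationRing_of_eq_colon`, `height_eq_one_of_eq_colon`,
  `height_eq_one_of_isAssociatedPrime`;
* (ii) `R = ⋂_{ht P = 1} R_P` — `mem_span_singleton_of_forall_height_eq_one` (divisibility form: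
  `b ∈ a R_P` for all height-one `P` implies `b ∈ aR`; proof through an associated prime of
  `R/aR` containing `(aR : b)` rather than a primary decomposition) and
  `exists_algebraMap_eq_of_forall_height_eq_one` (for elements of the fraction field);
* `isRegularLocalRing_of_isIntegrallyClosed_of_ringKrullDim_le_one` — a normal Noetherian local
  domain of dimension `≤ 1` is a field or a DVR (Matsumura Thm. 11.2), hence regular.

These give the «algebraic Hartogs» property of normal varieties used for Riemann's existence
theorem (`Literature/AlgebraicGeometry/FundamentalGroup/`): a rational function regular at all
codimension-one points of a normal variety is regular. Everything is proved; no definitions, no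
named facts.

## References

* [Matsumura1987] H. Matsumura, *Commutative Ring Theory*, Cambridge Studies in Advanced
  Mathematics 8 (1986), §11: Thm. 11.2 (p. 79), Thm. 11.4, Thm. 11.5 and its Corollary (p. 82)
  (p0097 of the materialised text `lit read book:matsumura1986-commutative-ring-theory`).

#harness_tags commutative_algebra.normal_rings, algebraic_geometry.sga1
-/


namespace Literature.RingTheory.IntegralClosure

open IsLocalRing

variable {R : Type*} [CommRing R] [IsDomain R]

/-! ### Prime divisors of principal ideals in a normal domain -/

section PrimeDivisor

variable [IsNoetherianRing R] [IsIntegrallyClosed R] {a c : R} {P : Ideal R} [hP : P.IsPrime]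

/-- **Matsumura 11.5 (i), local form.** In a normal Noetherian domain, if a prime `P` is a prime
divisor of a non-zero principal ideal, `P = (aR : c)` with `a ≠ 0`, then the maximal ideal of `R_P`
is principal: with `x = c/a` one has `x P ⊆ R`; `x P ⊆ P` would make `x` integral (determinant
trick), hence in `R`, so `c ∈ aR` and `P = R`; thus `x p₀ = s ∉ P` for some `p₀ ∈ P`, and then
`P R_P = p₀ R_P`. [cite: Matsumura1987, Thm. 11.5 (i) (p. 82)] -/
theorem isPrincipal_maximalIdeal_of_eq_colon (ha : a ≠ 0)
    (hPc : ∀ r : R, r ∈ P ↔ r * c ∈ Ideal.span {a}) :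
    (maximalIdeal (Localization.AtPrime P)).IsPrincipal := by
  classical
  -- `p c = r_p a` for `p ∈ P`
  have hdiv : ∀ p ∈ P, ∃ r : R, p * c = r * a := fun p hp ↦ by
    obtain ⟨r, hr⟩ := Ideal.mem_span_singleton'.mp ((hPc p).mp hp)
    exact ⟨r, hr.symm⟩
  choose! rr hrr using hdiv
  have hPtop : P ≠ ⊤ := hP.ne_top
  by_cases hcase : ∀ p ∈ P, rr p ∈ P
  · -- `x = c/a` is integral over `R`, hence in `R`; then `1 ∈ P`
    exfalso
    let K := FractionRing R
    let x : K := algebraMap R K c / algebraMap R K a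
    have haK : algebraMap R K a ≠ 0 := IsFractionRing.to_map_eq_zero_iff.not.mpr ha
    let M : Submodule R K := Submodule.map (Algebra.linearMap R K) P
    have hxM : ∀ y ∈ M, x • y ∈ M := by
      rintro _ ⟨p, hp, rfl⟩
      refine ⟨rr p, hcase p hp, ?_⟩
      change algebraMap R K (rr p) = x * algebraMap R K p
      rw [div_mul_eq_mul_div, eq_div_iff haK, ← map_mul, ← map_mul, ← hrr p hp, mul_comm]
    have haP : a ∈ P := (hPc a).mpr (Ideal.mem_span_singleton'.mpr ⟨c, by ring⟩)
    have hM0 : M ≠ ⊥ := by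
      rw [Submodule.ne_bot_iff]
      exact ⟨_, ⟨a, haP, rfl⟩, haK⟩
    have hMfg : M.FG := Submodule.FG.map _ (IsNoetherian.noetherian P)
    have hint : IsIntegral R x := isIntegral_of_smul_mem_submodule M hM0 hMfg x hxM
    obtain ⟨y, hy⟩ := IsIntegrallyClosed.algebraMap_eq_of_integral hint
    have hcy : c = y * a := by
      apply IsFractionRing.injective R K
      rw [map_mul, hy, div_mul_cancel₀ _ haK]
    exact hPtop ((Ideal.eq_top_iff_one P).mpr ((hPc 1).mpr
      (Ideal.mem_span_singleton'.mpr ⟨y, by rw [one_mul, hcy]⟩)))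
  · -- some `p₀ ∈ P` with `s = rr p₀ ∉ P`: then `P R_P = p₀ R_P`
    push Not at hcase
    obtain ⟨p₀, hp₀, hs⟩ := hcase
    set Rp := Localization.AtPrime P
    have hsu : IsUnit (algebraMap R Rp (rr p₀)) :=
      (IsLocalization.AtPrime.isUnit_to_map_iff Rp P (rr p₀)).mpr hs
    refine ⟨⟨algebraMap R Rp p₀, le_antisymm ?_ ?_⟩⟩
    · rw [← Localization.AtPrime.map_eq_maximalIdeal, Ideal.map_le_iff_le_comap]
      intro p hp
      -- `s p = rr p * p₀` in `R`
      have key : rr p₀ * p = rr p * p₀ := by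
        apply mul_left_cancel₀ ha
        calc a * (rr p₀ * p) = (p₀ * c) * p := by rw [hrr p₀ hp₀]; ring
          _ = p₀ * (p * c) := by ring
          _ = a * (rr p * p₀) := by rw [hrr p hp]; ring
      rw [Ideal.mem_comap]
      change algebraMap R Rp p ∈ Ideal.span {algebraMap R Rp p₀}
      refine Ideal.mem_span_singleton'.mpr ⟨hsu.unit⁻¹ * algebraMap R Rp (rr p), ?_⟩
      rw [mul_assoc, ← map_mul, ← key, map_mul, ← mul_assoc, IsUnit.val_inv_mul, one_mul]
    · rw [Ideal.span_le, Set.singleton_subset_iff]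
      exact (IsLocalization.AtPrime.to_map_mem_maximal_iff Rp P p₀).mpr hp₀

/-- **Matsumura 11.5 (i).** In a normal Noetherian domain a prime divisor `P = (aR : c)` of a
non-zero principal ideal `aR` has height one, and `R_P` is a discrete valuation ring.
[cite: Matsumura1987, Thm. 11.5 (i) (p. 82)] -/
theorem isDiscreteValuationRing_of_eq_colon (ha : a ≠ 0)
    (hPc : ∀ r : R, r ∈ P ↔ r * c ∈ Ideal.span {a}) :
    IsDiscreteValuationRing (Localization.AtPrime P) := by
  set Rp := Localization.AtPrime P
  haveI : IsNoetherianRing Rp := IsLocalization.isNoetherianRing P.primeCompl Rp inferInstance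
  have haP : a ∈ P := (hPc a).mpr (Ideal.mem_span_singleton'.mpr ⟨c, by ring⟩)
  have hnf : ¬IsField Rp := by
    rw [IsLocalRing.isField_iff_maximalIdeal_eq]
    intro h
    have : algebraMap R Rp a ∈ maximalIdeal Rp :=
      (IsLocalization.AtPrime.to_map_mem_maximal_iff Rp P a).mpr haP
    rw [h, Ideal.mem_bot] at this
    exact ha (IsLocalization.injective Rp P.primeCompl_le_nonZeroDivisors
      (by rw [this, map_zero]))
  exact ((IsDiscreteValuationRing.TFAE Rp hnf).out 0 4).mpr
    (isPrincipal_maximalIdeal_of_eq_colon ha hPc)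

/-- **Matsumura 11.5 (i), height form.** [cite: Matsumura1987, Thm. 11.5 (i) (p. 82)] -/
theorem height_eq_one_of_eq_colon (ha : a ≠ 0)
    (hPc : ∀ r : R, r ∈ P ↔ r * c ∈ Ideal.span {a}) : P.height = 1 := by
  haveI := isDiscreteValuationRing_of_eq_colon ha hPc
  have h1 := IsLocalization.AtPrime.ringKrullDim_eq_height P (Localization.AtPrime P)
  rw [IsDiscreteValuationRing.ringKrullDim_eq_one] at h1
  exact_mod_cast h1.symm

omit hP in
/-- **Matsumura 11.5 (i), as printed**: in a normal Noetherian domain all the prime divisors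
(associated primes of `R/aR`) of a non-zero principal ideal `aR` have height one.
[cite: Matsumura1987, Thm. 11.5 (i) (p. 82)] -/
theorem height_eq_one_of_isAssociatedPrime (ha : a ≠ 0)
    (hPa : IsAssociatedPrime P (R ⧸ Ideal.span {a})) : P.height = 1 := by
  obtain ⟨hPprime, y, hy⟩ := isAssociatedPrime_iff.mp hPa
  obtain ⟨c, rfl⟩ := Ideal.Quotient.mk_surjective y
  haveI := hPprime
  refine height_eq_one_of_eq_colon (c := c) ha fun r ↦ ?_
  rw [hy, Submodule.mem_colon_singleton, Submodule.mem_bot, Algebra.smul_def,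
    Ideal.Quotient.algebraMap_eq, ← map_mul, Ideal.Quotient.eq_zero_iff_mem]

end PrimeDivisor

/-! ### `R = ⋂_{ht P = 1} R_P` -/

section Intersection

variable [IsNoetherianRing R] [IsIntegrallyClosed R]

/-- **Matsumura 11.5 (ii)** («`R = ⋂_{ht P = 1} R_P`», divisibility form): in a normal Noetherian
domain, if `b ∈ a R_P` for every height-one prime `P` (`a ≠ 0`), then `b ∈ aR`. Proof: otherwise
`(aR : b)` is a proper ideal, contained in an associated prime `P = (aR : c)` of `R/aR`, which has
height one by (i); but `s b ∈ aR` with `s ∉ P` puts `s ∈ (aR : b) ⊆ P`.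
[cite: Matsumura1987, Thm. 11.5 (ii) (p. 82)] -/
theorem mem_span_singleton_of_forall_height_eq_one {a b : R} (ha : a ≠ 0)
    (h : ∀ P : Ideal R, P.IsPrime → P.height = 1 → ∃ s ∉ P, s * b ∈ Ideal.span {a}) :
    b ∈ Ideal.span {a} := by
  classical
  by_contra hb
  let M := R ⧸ Ideal.span {a}
  have hx : (Ideal.Quotient.mk (Ideal.span {a}) b : M) ≠ 0 :=
    fun h0 ↦ hb (Ideal.Quotient.eq_zero_iff_mem.mp h0)
  obtain ⟨P, hPass, hle⟩ := exists_le_isAssociatedPrime_of_isNoetherianRing R _ hx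
  obtain ⟨hPprime, y, hy⟩ := isAssociatedPrime_iff.mp hPass
  obtain ⟨c, rfl⟩ := Ideal.Quotient.mk_surjective y
  haveI := hPprime
  -- `P = (aR : c)`
  have hPc : ∀ r : R, r ∈ P ↔ r * c ∈ Ideal.span {a} := fun r ↦ by
    rw [hy, Submodule.mem_colon_singleton, Submodule.mem_bot, Algebra.smul_def,
      Ideal.Quotient.algebraMap_eq, ← map_mul, Ideal.Quotient.eq_zero_iff_mem]
  obtain ⟨s, hsP, hsb⟩ := h P hPprime (height_eq_one_of_eq_colon ha hPc)
  refine hsP (hle ?_)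
  rw [Submodule.mem_colon_singleton, Submodule.mem_bot, Algebra.smul_def,
    Ideal.Quotient.algebraMap_eq, ← map_mul, Ideal.Quotient.eq_zero_iff_mem]
  exact hsb

/-- **Matsumura 11.5 (ii)** for the field of fractions: an element of `Frac R` lying in `R_P` for
every height-one prime `P` of the normal Noetherian domain `R` lies in `R`.
[cite: Matsumura1987, Thm. 11.5 (ii) (p. 82)] -/
theorem exists_algebraMap_eq_of_forall_height_eq_one {K : Type*} [Field K] [Algebra R K]
    [IsFractionRing R K] (x : K)
    (h : ∀ P : Ideal R, P.IsPrime → P.height = 1 →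
      ∃ s ∉ P, ∃ r : R, algebraMap R K s * x = algebraMap R K r) :
    ∃ y : R, algebraMap R K y = x := by
  obtain ⟨b, a, ha, rfl⟩ := IsFractionRing.div_surjective (A := R) x
  have ha0 : a ≠ 0 := nonZeroDivisors.ne_zero ha
  have haK : algebraMap R K a ≠ 0 := IsFractionRing.to_map_eq_zero_iff.not.mpr ha0
  have hb : b ∈ Ideal.span {a} := by
    refine mem_span_singleton_of_forall_height_eq_one ha0 fun P hP hP1 ↦ ?_
    obtain ⟨s, hs, r, hr⟩ := h P hP hP1
    refine ⟨s, hs, Ideal.mem_span_singleton'.mpr ⟨r, ?_⟩⟩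
    apply IsFractionRing.injective R K
    rw [map_mul, map_mul, ← hr, mul_div_assoc', div_mul_cancel₀ _ haK]
  obtain ⟨y, hy⟩ := Ideal.mem_span_singleton'.mp hb
  exact ⟨y, by rw [← hy, map_mul, mul_div_assoc, div_self haK, mul_one]⟩

end Intersection

/-! ### Normal local domains of dimension `≤ 1` -/

section DimOne

/-- A normal Noetherian local domain of dimension `≤ 1` is a discrete valuation ring or a field
(Matsumura Thm. 11.2), in particular a regular local ring. [cite: Matsumura1987, Thm. 11.2 (p. 79)] -/
theorem isRegularLocalRing_of_isIntegrallyClosed_of_ringKrullDim_le_one (R : Type*) [CommRing R]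
    [IsDomain R] [IsNoetherianRing R] [IsLocalRing R] [IsIntegrallyClosed R]
    (h : ringKrullDim R ≤ 1) : IsRegularLocalRing R := by
  by_cases hF : IsField R
  · letI := hF.toField
    infer_instance
  · haveI : Ring.KrullDimLE 1 R := Ring.krullDimLE_iff.mpr h
    have hm : maximalIdeal R ≠ ⊥ := (IsLocalRing.isField_iff_maximalIdeal_eq.not.mp hF)
    haveI : IsDiscreteValuationRing R := by
      have htf : IsDiscreteValuationRing R ↔
          IsIntegrallyClosed R ∧ ∃! P : Ideal R, P ≠ ⊥ ∧ P.IsPrime :=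
        (IsDiscreteValuationRing.TFAE R hF).out 0 3
      refine htf.mpr ⟨‹_›, maximalIdeal R, ⟨hm, inferInstance⟩, fun P hP ↦ ?_⟩
      haveI := hP.2
      exact IsLocalRing.eq_maximalIdeal (hP.2.isMaximal_of_ne_bot hP.1)
    infer_instance

end DimOne

end Literature.RingTheory.IntegralClosure
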